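import Literature.AnabelianGeometry.AbsoluteAnabelian.MonoidKummerMapsMonoAnalyticLiftHolds
import Mathlib.Topology.Algebra.Group.OpenMapping
import Mathlib.Topology.Baire.LocallyCompactRegular
import Mathlib.FieldTheory.Galois.Profinite
import HarnessLib

/-!
# [AbsTopIII] Prop 3.2 (iv) / 3.3 (ii): the lifting sentences for σ-COMPACT `Π`, UNCONDITIONALLY
# (the open mapping theorem replaces compactness; Nikolov–Segal is needed only beyond σ-compact `Π`)

Proof-only companion (theorems only, no new definitions) of abc-iut-L4-t2's `MonoidKummerMaps.lean`
(S. Mochizuki, *Topics in Absolute Anabelian Geometry III*, Def. 3.1 (i)/(ii) pp. 66–67, Prop. 3.2 (iv)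
p. 72, Prop. 3.3 (ii) p. 74; kurims manuscript, lit key `paper:url-5493eb38cbb7`), sharpening this seat's
`MonoidKummerMapsTLGLiftCompactProofs.lean` (gen 3) / `MonoidKummerMapsMonoAnalyticLiftHolds.lean` (gen 4):
there the covered Galois isomorphism of an admissible `Π ⥲ Π*` was shown continuous for COMPACT `Π`
(the augmentation `ε : Π ↠ Gal(k̄/k)` is then a quotient map).  By the OPEN MAPPING THEOREM for
topological groups (Mathlib `MonoidHom.isOpenMap_of_sigmaCompact`: a continuous surjective homomorphism
from a σ-compact group onto a Baire Hausdorff group is open; `Gal(k̄/k)` is compact Hausdorff, hence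
Baire) the same holds for every σ-COMPACT `Π` — e.g. profinite `Π`, countable discrete `Π`, second
countable locally compact `Π`.  Consequently, with (BA) PROVED (`biAnabelianUnits_holds`, local class
field theory), the `TLG`/`TCG` lifting sentences and the schemata `GaloisIsoLiftsToTMPairIso H` (F-0409),
`UnitPairIsoFibresOfType H` (F-0413) hold UNCONDITIONALLY for every hypothesis predicate `H` under which
`Π` is σ-compact; the Nikolov–Segal input (F-1977, `MonoidKummerMapsTLGLiftOfFiniteIndexOpen.lean`) is
needed only for pairs whose `Π` is not σ-compact (e.g. `Gal(k̄/k)` with the discrete topology, the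
witness of `MonoidKummerMapsTLGLiftForcesContinuity.lean`).

* `ModelMLFGaloisData.isOpenMap_aug_of_sigmaCompactSpace`, `…exists_galoisContinuousMulEquiv_of_sigmaCompactSpace`;
* `tlgLifting_sigmaCompact_holds`, `tcgLifting_sigmaCompact_holds`;
* `galoisIsoLiftsToTMPairIso_of_sigmaCompact_holds` (F-0409, every σ-compact-`Π` predicate),
  `unitPairIsoFibresOfType_of_sigmaCompact_holds` (F-0413, likewise).

HONEST FRAMING: OUR kernel check of classical topological-group plumbing on statements of a refereed
paper; nothing here bears on [IUTchIII] Cor. 3.12 or asserts anything about abc.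
-/

noncomputable section

open scoped nonZeroDivisors

namespace Literature.AnabelianGeometry.AbsoluteAnabelian

/-! ### §1. Model level: σ-compact `Π` ⇒ `ε` open ⇒ the covered Galois isomorphism is continuous -/

section Model

variable {C₁ C₂ : MLFClosure.{0}} (D₁ : ModelMLFGaloisData C₁.k C₁.K) (D₂ : ModelMLFGaloisData C₂.k C₂.K)

/-- For model data with σ-COMPACT `Π_k` the augmentation `ε_k : Π_k ↠ Gal(k̄/k)` is an OPEN map (open
mapping theorem: `Gal(k̄/k)` is compact Hausdorff, hence Baire).
[cite: MochizukiAbsTopIII2015, Definition 3.1 (i) p.66] -/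
theorem ModelMLFGaloisData.isOpenMap_aug_of_sigmaCompactSpace (C : MLFClosure.{0})
    (D : ModelMLFGaloisData C.k C.K) [SigmaCompactSpace D.Pi] : IsOpenMap D.aug := by
  haveI : IsGalois C.k C.K := {}
  haveI : CompactSpace (C.K ≃ₐ[C.k] C.K) := inferInstance
  haveI : T2Space (C.K ≃ₐ[C.k] C.K) := inferInstance
  haveI : BaireSpace (C.K ≃ₐ[C.k] C.K) := BaireSpace.of_t2Space_locallyCompactSpace
  exact MonoidHom.isOpenMap_of_sigmaCompact D.aug D.aug_surjective D.continuous_aug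

/-- For model data with σ-compact `Π₁`, `Π₂`, every admissible `f : Π₁ ⥲ Π₂` covers an isomorphism of
TOPOLOGICAL Galois groups. [cite: MochizukiAbsTopIII2015, Definition 3.1 (ii) p.67] -/
theorem ModelMLFGaloisData.exists_galoisContinuousMulEquiv_of_sigmaCompactSpace
    [SigmaCompactSpace D₁.Pi] [SigmaCompactSpace D₂.Pi] (f : D₁.Pi ≃ₜ* D₂.Pi)
    (hf : D₁.aug.ker.map f.toMulEquiv.toMonoidHom = D₂.aug.ker) :
    ∃ α : (C₁.K ≃ₐ[C₁.k] C₁.K) ≃ₜ* (C₂.K ≃ₐ[C₂.k] C₂.K), ∀ g, α (D₁.aug g) = D₂.aug (f g) :=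
  ModelMLFGaloisData.exists_galoisContinuousMulEquiv_of_isOpenMap D₁ D₂
    (ModelMLFGaloisData.isOpenMap_aug_of_sigmaCompactSpace C₁ D₁)
    (ModelMLFGaloisData.isOpenMap_aug_of_sigmaCompactSpace C₂ D₂) f hf

end Model

/-! ### §2. Pair level: the lifting sentences for σ-compact `Π`, unconditionally -/

/-- **`TLG` lifting for σ-compact `Π`, UNCONDITIONALLY**: every admissible isomorphism of topological
groups between MLF-Galois `TLG`-pairs with σ-compact underlying groups lifts to an isomorphism of pairs
((BA) = `biAnabelianUnits_holds` + the open mapping theorem). [cite: MochizukiAbsTopIII2015, Proposition 3.3 (ii) p.74] -/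
theorem tlgLifting_sigmaCompact_holds (P Q : GaloisMonoidPair.{0}) (hP : IsMLFGaloisMonoidPair .TLG P)
    (hQ : IsMLFGaloisMonoidPair .TLG Q) (hPc : SigmaCompactSpace P.Pi) (hQc : SigmaCompactSpace Q.Pi)
    (f : P.Pi ≃ₜ* Q.Pi) (hf : P.actionKer.map f.toMulEquiv.toMonoidHom = Q.actionKer) :
    ∃ e : GaloisMonoidPair.Iso P Q, e.isoPi = f := by
  obtain ⟨C₁, D₁, P₁, hP₁, ⟨ι₁⟩⟩ := hP.exists_model
  obtain ⟨C₂, D₂, Q₂, hQ₂, ⟨ι₂⟩⟩ := hQ.exists_model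
  rw [ModelMLFGaloisData.monoidPair_TLG, Option.some.injEq] at hP₁ hQ₂
  subst hP₁
  subst hQ₂
  haveI : SigmaCompactSpace D₁.Pi := ι₁.isoPi.toHomeomorph.isClosedEmbedding.sigmaCompactSpace
  haveI : SigmaCompactSpace D₂.Pi := ι₂.isoPi.toHomeomorph.isClosedEmbedding.sigmaCompactSpace
  set f' : D₁.Pi ≃ₜ* D₂.Pi := ι₁.isoPi.trans (f.trans ι₂.isoPi.symm) with hf'
  have hf'k : D₁.aug.ker.map f'.toMulEquiv.toMonoidHom = D₂.aug.ker := by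
    have hcomp : f'.toMulEquiv.toMonoidHom = ι₂.isoPi.symm.toMulEquiv.toMonoidHom.comp
        (f.toMulEquiv.toMonoidHom.comp ι₁.isoPi.toMulEquiv.toMonoidHom) := MonoidHom.ext fun _ => rfl
    rw [← ModelMLFGaloisData.tlgPair_actionKer C₁ D₁, ← ModelMLFGaloisData.tlgPair_actionKer C₂ D₂, hcomp,
      ← Subgroup.map_map, ← Subgroup.map_map, ι₁.map_actionKer, hf, ι₂.symm_map_actionKer]
  obtain ⟨α, hα⟩ :=
    ModelMLFGaloisData.exists_galoisContinuousMulEquiv_of_sigmaCompactSpace D₁ D₂ f' hf'k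
  obtain ⟨β, hβ⟩ := biAnabelianUnits_holds C₁ C₂ α
  obtain ⟨e₁, he₁⟩ :=
    ModelMLFGaloisData.exists_tlgPair_iso_of_equivariant D₁ D₂ f' α.toMulEquiv hα β hβ
  refine ⟨⟨f, ι₁.isoM.symm.trans (e₁.isoM.trans ι₂.isoM), fun g x => ?_⟩, rfl⟩
  show ι₂.isoM (e₁.isoM (ι₁.isoM.symm (g • x))) = f g • ι₂.isoM (e₁.isoM (ι₁.isoM.symm x))
  rw [GaloisMonoidPair.Iso.symm_smul_comm, e₁.smul_comm, ι₂.smul_comm, he₁]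
  show ι₂.isoPi (ι₂.isoPi.symm (f (ι₁.isoPi (ι₁.isoPi.symm g)))) • _ = _
  rw [ContinuousMulEquiv.apply_symm_apply, ContinuousMulEquiv.apply_symm_apply]

/-- σ-compactness passes from a pair to the `TLG`-pair of any of its `TM`-models (homeomorphic groups).
[cite: MochizukiAbsTopIII2015, Definition 3.1 (ii) p.67] -/
private theorem sigmaCompactSpace_tlgPair_of_tmPair_iso (C : MLFClosure.{0})
    (D : ModelMLFGaloisData C.k C.K) (P : GaloisMonoidPair.{0})
    (h : Nonempty (GaloisMonoidPair.Iso D.tmPair P)) (hP : SigmaCompactSpace P.Pi) :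
    SigmaCompactSpace D.tlgPair.Pi := by
  obtain ⟨ι⟩ := h
  exact ι.isoPi.toHomeomorph.isClosedEmbedding.sigmaCompactSpace

/-- σ-compactness passes from a pair to the `TLG`-pair of any of its `TCG`-models. [folklore] -/
private theorem sigmaCompactSpace_tlgPair_of_tcgPair_iso (C : MLFClosure.{0})
    (D : ModelMLFGaloisData C.k C.K) (P : GaloisMonoidPair.{0})
    (h : Nonempty (GaloisMonoidPair.Iso D.tcgPair P)) (hP : SigmaCompactSpace P.Pi) :
    SigmaCompactSpace D.tlgPair.Pi := by
  obtain ⟨ι⟩ := h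
  exact ι.isoPi.toHomeomorph.isClosedEmbedding.sigmaCompactSpace

/-- **F-0409 `GaloisIsoLiftsToTMPairIso H` UNCONDITIONALLY for every hypothesis predicate `H` under which
`Π` is σ-compact** ([AbsTopIII] Prop. 3.2 (iv), author's corrected form; via abc-iut-L6-t21's relative
`TM ⇐ TLG` reduction). [cite: MochizukiAbsTopIII2015, Proposition 3.2 (iv) p.72]
[cite: MochizukiAbsTopIIIComments2019, item (5)] -/
theorem galoisIsoLiftsToTMPairIso_of_sigmaCompact_holds (H : GaloisMonoidPair.{0} → Prop)
    (hH : ∀ P, H P → SigmaCompactSpace P.Pi) :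
    Literature.AnabelianGeometry.AbsoluteAnabelian.GaloisIsoLiftsToTMPairIso H :=
  galoisIsoLiftsToTMPairIso_of_tlgLifting_relative H (fun P => SigmaCompactSpace P.Pi)
    (fun C D P hι hHP => sigmaCompactSpace_tlgPair_of_tmPair_iso C D P hι (hH P hHP))
    (fun P Q hP hQ hPc hQc f hf => tlgLifting_sigmaCompact_holds P Q hP hQ hPc hQc f hf)

/-- **`TCG` lifting UNCONDITIONALLY for σ-compact-`Π` hypothesis predicates** ([AbsTopIII] Prop. 3.3 (ii)).
[cite: MochizukiAbsTopIII2015, Proposition 3.3 (ii) p.74] -/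
theorem tcgLifting_sigmaCompact_holds (H : GaloisMonoidPair.{0} → Prop)
    (hH : ∀ P, H P → SigmaCompactSpace P.Pi) (P Q : GaloisMonoidPair.{0})
    (hP : IsMLFGaloisMonoidPair .TCG P) (hQ : IsMLFGaloisMonoidPair .TCG Q) (hHP : H P) (hHQ : H Q)
    (f : P.Pi ≃ₜ* Q.Pi) (hf : P.actionKer.map f.toMulEquiv.toMonoidHom = Q.actionKer) :
    ∃ e : GaloisMonoidPair.Iso P Q, e.isoPi = f :=
  tcgLifting_of_tlgLifting_relative H (fun P => SigmaCompactSpace P.Pi)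
    (fun C D P hι hHP => sigmaCompactSpace_tlgPair_of_tcgPair_iso C D P hι (hH P hHP))
    (fun P Q hP hQ hPc hQc f hf => tlgLifting_sigmaCompact_holds P Q hP hQ hPc hQc f hf)
    P Q hP hQ hHP hHQ f hf

/-- **F-0413 `UnitPairIsoFibresOfType H` UNCONDITIONALLY for every σ-compact-`Π` hypothesis predicate `H`**
([AbsTopIII] Prop. 3.3 (ii) as corrected, both clauses; the `TLG` two-lift clause via abc-iut-L6-t21's
`unitPairIso_fibre_two_of_exists_lift`). [cite: MochizukiAbsTopIII2015, Proposition 3.3 (ii) p.74]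
[cite: MochizukiAbsTopIIIComments2019, item (5)] -/
theorem unitPairIsoFibresOfType_of_sigmaCompact_holds (H : GaloisMonoidPair.{0} → Prop)
    (hH : ∀ P, H P → SigmaCompactSpace P.Pi) :
    Literature.AnabelianGeometry.AbsoluteAnabelian.UnitPairIsoFibresOfType H :=
  unitPairIsoFibresOfType_of_tlgLifting_relative H (fun P => SigmaCompactSpace P.Pi)
    (fun C D P hι hHP => sigmaCompactSpace_tlgPair_of_tcgPair_iso C D P hι (hH P hHP))
    (fun P Q hP hQ hPc hQc f hf => tlgLifting_sigmaCompact_holds P Q hP hQ hPc hQc f hf)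
    (fun P Q hP hQ hHP hHQ f hf =>
      unitPairIso_fibre_two_of_exists_lift P Q hP f
        (tlgLifting_sigmaCompact_holds P Q hP hQ (hH P hHP) (hH Q hHQ) f hf))

end Literature.AnabelianGeometry.AbsoluteAnabelian

end
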